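import Literature.NumberTheory.Automorphic.ResGL2TorusGrossencharakter
import Literature.NumberTheory.Automorphic.AutomorphicRepsGLSatakeScalars
import Literature.NumberTheory.Automorphic.AutomorphicRepsGLSatakeFlathProofs
import HarnessLib

/-!
# `Harder1987_eigensystem_cuspidalOrEisenstein` reduced to the Eichler–Shimura–Harder comparison

Topic `NumberTheory/Automorphic`; namespace `Literature.NumberTheory.Automorphic.ResGLnCohomology`.
One theorem (no definition, no named fact, no `sorry`); the `Res_{F/ℚ} GL₂` (totally real `F`)
analogue of `BianchiInteriorEigenclassReduction` / `ResGLnCuspidalEigenclassOfComparison`.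

After `ResGL2TorusGrossencharakter` (`Harder1987_eigensystem_cuspidalOrEisenstein_of_interior`:
the whole Eisenstein half of the fact is a theorem of the tree) the named fact
`Harder1987_eigensystem_cuspidalOrEisenstein` is equivalent to its INTERIOR half.  This file
reduces that half to exactly one statement absent from the tree, the COMPARISON on the side of
automorphic forms (hypothesis `hC`): a non-zero interior Hecke eigenclass of
`H^q(S_{K_f(𝔫)}, Ẽ_λ)` is matched EITHER by a `K(𝔪)`-spherical form `φ ∈ W ∖ W'` of a regular
algebraic CUSPIDAL `π₀` of `GL₂(𝔸_F)` which is, modulo `W'`, an eigenform of the double cosets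
`T_{w,j}(ϖ_w) = [K(𝔪) t_{w,j}(ϖ_w) K(𝔪)]` with the eigenvalues `ι(a_{w,j})` at almost all `w`
(`H^q_! ⊆ H^q_cusp ⊕ H^q_{!,res}`, `H^q_cusp = ⊕_π H^q(𝔤, K_∞; π_∞ ⊗ E_λ) ⊗ π_f^{K_f}`
Hecke-equivariantly [Harder1987, §3.1 (3.1.1)–(3.1.4), §3.2 Prop. 3.2.4, (3.2.5)];
[Borel1983Regularization]; [Franke1998, Thm. 18]; cohomological `π_∞` are regular algebraic
[Clozel1990, Lemme 3.14]), OR by the Eisenstein clause (the residual interior classes, those of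
`φ ∘ det` [Harder1987, §3.2 (3.2.5)]).  Everything else — the scalars of `T_{w,j}(ϖ_w)` on
`π₀^{K(𝔪)}` exist (`Flath1979_heckeOperator_ofLocal_sub_smul_mem_holds`) and are the Satake–Tamagawa
eigenvalues `q_w^{j(2−j)/2} e_j(α_w)` of a Satake parameter (`exists_hasSatakeParamAt_and_eq_esymm`),
and the Eisenstein half — is proved:
`Harder1987_eigensystem_cuspidalOrEisenstein_of_eigenformComparison`.

## References

* G. Harder, *Eisenstein cohomology of arithmetic groups. The case GL₂*, Invent. Math. 89 (1987),
  §3.1–3.2, §4.2 Thm. 2. [Harder1987]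
* A. Borel, Duke Math. J. 50 (1983), Thm. 5.3, Cor. 5.5. [Borel1983Regularization]
* J. Franke, Ann. Sci. ÉNS 31 (1998), Thm. 18. [Franke1998]
* L. Clozel, *Motifs et formes automorphes* (1990), Lemme 3.14. [Clozel1990]
* D. Flath, Corvallis 1979, Thm. 3. [FlathCorvallis1979]
-/

noncomputable section

open scoped Classical
open NumberField IsDedekindDomain

namespace Literature.NumberTheory.Automorphic

namespace ResGLnCohomology

open Literature.NumberTheory.GaloisRepresentations

/-- The fixed uniformiser `ϖ_v = BigHeckeGLn.uniformizerAt v` has valuation `exp (-1)`. [folklore] -/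
theorem valued_coe_uniformizerAt {K : Type} [Field K] [NumberField K] (v : HeightOneSpectrum (𝓞 K)) :
    Valued.v ((BigHeckeGLn.uniformizerAt v : (v.adicCompletion K)ˣ) : v.adicCompletion K) =
      WithZero.exp (-1 : ℤ) := by
  change Valued.v ((Classical.choose (v.valuation_exists_uniformizer K) : K) : v.adicCompletion K) = _
  rw [HeightOneSpectrum.valuedAdicCompletion_eq_valuation']
  exact Classical.choose_spec (v.valuation_exists_uniformizer K)

/-- **`Harder1987_eigensystem_cuspidalOrEisenstein` from the comparison for interior eigenclasses.**
Hypothesis `hC` (the COMPARISON, not yet a theorem of the tree): for `F` totally real, `𝔫 ≠ 0`, a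
weight `λ`, a degree `q` and a non-zero INTERIOR class `c` (`interiorLevelCohomology`) which is an
eigenvector of `T_{w,1}, T_{w,2}` with eigenvalues `a_{w,1}, a_{w,2}` at almost all `w`, EITHER there
are a regular algebraic cuspidal `π₀` on `GL₂(𝔸_F)`, a level `𝔪 ≠ 0` and a `K(𝔪)`-invariant form
`φ ∈ W ∖ W'` of `π₀` with `T_{w,j}(ϖ_w) φ ≡ ι(a_{w,j}) φ (mod W')` (`j = 1, 2`) at almost all `w`
[cite: Harder1987, §3.1 (3.1.1)–(3.1.4), §3.2 Prop. 3.2.4] [cite: Borel1983Regularization, Thm. 5.3,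
Cor. 5.5] [cite: Franke1998, Thm. 18] [cite: Clozel1990, Lemme 3.14], OR the eigenvalues are
Eisenstein (`ι(a_{w,1}) = ψ₁(w) + ψ₂(w)`, `N(w) ι(a_{w,2}) = ψ₁(w) ψ₂(w)` for Größencharaktere
`ψ₁, ψ₂`; the residual interior classes [cite: Harder1987, §3.2 (3.2.5)]).  Conclusion: the named
fact, by `exists_hasSatakeParamAt_and_eq_esymm` [cite: FlathCorvallis1979, Thm. 3] and the proved
Eisenstein half `Harder1987_eigensystem_cuspidalOrEisenstein_of_interior`. -/
theorem Harder1987_eigensystem_cuspidalOrEisenstein_of_eigenformComparison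
    (hC : ∀ (F : Type) [Field F] [NumberField F], NumberField.IsTotallyReal F →
      ∀ (hcpt : isCompact_glFiniteIntegralLevel 2 F) (E : Type) [Field E] (ι : E ≃+* ℂ)
        (𝔫 : Ideal (𝓞 F)), 𝔫 ≠ 0 →
      ∀ (lam : (F →+* E) → Fin 2 → ℤ) (q : ℕ) (c : levelCohomology E 2 F 𝔫 lam q),
        c ∈ interiorLevelCohomology E 2 F 𝔫 lam q → c ≠ 0 →
      ∀ (a : HeightOneSpectrum (𝓞 F) → ℕ → E),
        (∀ᶠ w in Filter.cofinite, heckeT E 2 F 𝔫 lam q w 1 c = a w 1 • c ∧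
          heckeT E 2 F 𝔫 lam q w 2 c = a w 2 • c) →
        (∃ (π₀ : CuspidalAutomorphicRepData 2 F hcpt) (𝔪 : Ideal (𝓞 F))
            (φ : (AdelicGroupData.gl 2 F).Adelic → ℂ),
          π₀.1.IsRegularAlgebraic ∧ 𝔪 ≠ 0 ∧ φ ∈ π₀.1.W ∧ φ ∉ π₀.1.W' ∧
          (∀ u ∈ principalCongruenceLevel 2 F 𝔪, rightTranslation (AdelicGroupData.gl 2 F) u φ = φ) ∧
          ∀ᶠ w in Filter.cofinite, ∀ j, 1 ≤ j → j ≤ 2 →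
            heckeOperator (rightTranslation (AdelicGroupData.gl 2 F)) (principalCongruenceLevel 2 F 𝔪)
              (heckeDiagAt 2 F w (BigHeckeGLn.uniformizerAt w) j) φ - ι (a w j) • φ ∈ π₀.1.W') ∨
        (∃ (𝔣 : Ideal (𝓞 F)) (p₁ q₁ p₂ q₂ : InfinitePlace F → ℤ)
            (ψ₁ ψ₂ : HeightOneSpectrum (𝓞 F) → ℂ),
          𝔣 ≠ ⊥ ∧ IsGrossencharakter 𝔣 p₁ q₁ ψ₁ ∧ IsGrossencharakter 𝔣 p₂ q₂ ψ₂ ∧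
          ∀ᶠ w in Filter.cofinite, ι (a w 1) = ψ₁ w + ψ₂ w ∧
            ((Ideal.absNorm w.asIdeal : ℕ) : ℂ) * ι (a w 2) = ψ₁ w * ψ₂ w)) :
    Harder1987_eigensystem_cuspidalOrEisenstein := by
  refine Harder1987_eigensystem_cuspidalOrEisenstein_of_interior ?_
  intro F _ _ hF hcpt E _ ι 𝔫 h𝔫 lam q c hc hc0 a ha
  rcases hC F hF hcpt E ι 𝔫 h𝔫 lam q c hc hc0 a ha with
    ⟨π₀, 𝔪, φ, hreg, h𝔪, hφW, hφW', hfix, hev⟩ | hE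
  · refine Or.inl ⟨π₀, hreg, ?_⟩
    have hS := π₀.1.Flath1979_heckeOperator_ofLocal_sub_smul_mem_holds
    have hcof : ∀ᶠ w : HeightOneSpectrum (𝓞 F) in Filter.cofinite, ¬ w.asIdeal ∣ 𝔪 := by
      rw [Filter.eventually_cofinite]
      exact (Ideal.finite_factors h𝔪).subset fun w hw => not_not.1 hw
    filter_upwards [hev, hcof] with w hw hw𝔪
    obtain ⟨α, hα, hj⟩ := π₀.1.exists_hasSatakeParamAt_and_eq_esymm hS h𝔪 hw𝔪
      (valued_coe_uniformizerAt w) hφW hφW' hfix (fun j => ι (a w j)) hw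
    refine ⟨α, hα, ?_, ?_⟩
    · rw [hj 1 le_rfl (by norm_num)]
      norm_num
    · rw [hj 2 (by norm_num) le_rfl]
      norm_num
  · exact Or.inr hE

end ResGLnCohomology

end Literature.NumberTheory.Automorphic

end
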